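import Literature.NumberTheory.Transcendental.KZLogCalculusProofs

/-!
# OffTetraSectorKernel (stmt-KontsevichZagierPeriods-10557), line odd-hyperbolic-ladder: stub stub_bandPartialFractions

Integrand additivity of the band carrier over the `k`-th roots. On the common band
`S = {0 < t < 1, 1 ≤ u ≤ 1/t^k}` of `ℝ²` the representation `Bk = [S, k t^{k−1} g_z(t^k)/u]`,
`g_z(s) = Im z / ((1 − s Re z)² + (s Im z)²) = Im (z/(1 − s z))`, and the `k` representations
`Fⱼ = [S, g_{wⱼ}(t)/u]` satisfy `[Bk] − Σⱼ [Fⱼ] ∈ relations`, GIVEN the pointwise identity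
`Σⱼ g_{wⱼ}(t) = k t^{k−1} g_z(t^k)` (a hypothesis here; it is the imaginary part of the
logarithmic derivative of `∏ⱼ (1 − wⱼ t) = 1 − z t^k`).

Proof: ONE iterated integrand-additivity move (Kontsevich–Zagier rule (1b),
`KZ.of_sub_of_sub_sum_mem_relations`) with a zero representation `R₀` on `S`
(`KZ.exists_zeroRep`): on `S`, `Bk.integrand = 0 + Σⱼ Fⱼ.integrand` by the hypothesis read at
`t := p 0` and `Finset.sum_div`; then `[Bk] − Σⱼ [Fⱼ] = ([Bk] − [R₀] − Σⱼ [Fⱼ]) + [R₀]` with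
`[R₀] ∈ relations` (`KZ.of_mem_relations_of_eqOn_zero`). No definitions are introduced.

References: M. Kontsevich, D. Zagier, *Periods* (2001), §1.2, rule (1).
-/

noncomputable section

open Set MeasureTheory
open Literature.NumberTheory.Transcendental

namespace Summit.KontsevichZagierPeriods.HyperbolicBloch.OffTetraSectorKernel

/-- STUB `stub_bandPartialFractions` (rule (1b), iterated: `KZ.of_sub_of_sub_sum_mem_relations`):
on the common band `{0<t<1, 1 ≤ u ≤ 1/t^k}` the integrand `k t^{k−1} g_z(t^k)/u` is the sum over
the `k`-th roots `wⱼ` of `z` of the integrands `g_{wⱼ}(t)/u` — GIVEN the pointwise identity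
(hypothesis; it is `stub_rootsPartialFractions`). One integrand-additivity move with a zero
representation on the band; the hypotheses `1 ≤ k` and the algebraicity of `z`, `wⱼ` are not used
(all representations are given). [cite: KontsevichZagier2001, §1.2 rule (1)] -/
theorem stub_bandPartialFractions :
    ∀ (k : ℕ), 1 ≤ k → ∀ (z : ℂ) (w : Fin k → ℂ), IsAlgebraic ℚ z → (∀ j, IsAlgebraic ℚ (w j)) →
    (∀ t : ℝ, ∑ j, (w j).im / ((1 - t * (w j).re) ^ 2 + (t * (w j).im) ^ 2) =
      k * t ^ (k - 1) * (z.im / ((1 - t ^ k * z.re) ^ 2 + (t ^ k * z.im) ^ 2))) →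
    ∀ (Bk : KZ.IntegralRep 2) (F : Fin k → KZ.IntegralRep 2),
      Bk.domain = {p | (0 < p 0 ∧ p 0 < 1) ∧ 1 ≤ p 1 ∧ p 1 ≤ 1 / p 0 ^ k} →
      Set.EqOn Bk.integrand
        (fun p => k * p 0 ^ (k - 1) * (z.im / ((1 - p 0 ^ k * z.re) ^ 2 + (p 0 ^ k * z.im) ^ 2)) /
          p 1) Bk.domain →
      (∀ j, (F j).domain = {p | (0 < p 0 ∧ p 0 < 1) ∧ 1 ≤ p 1 ∧ p 1 ≤ 1 / p 0 ^ k}) →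
      (∀ j, Set.EqOn (F j).integrand
        (fun p => (w j).im / ((1 - p 0 * (w j).re) ^ 2 + (p 0 * (w j).im) ^ 2) / p 1) (F j).domain) →
      KZ.of Bk - ∑ j, KZ.of (F j) ∈ KZ.relations := by
  intro k _ z w _ _ hid Bk F hBkd hBki hFd hFi
  have hFd' : ∀ j, (F j).domain = Bk.domain := fun j => (hFd j).trans hBkd.symm
  -- rule (1b), iterated integrand additivity with a zero representation `R₀` on the band
  obtain ⟨R₀, hR₀d, hR₀i⟩ := KZ.exists_zeroRep Bk.isSemialgebraic_domain
  have hsum : KZ.of Bk - KZ.of R₀ - ∑ j, KZ.of (F j) ∈ KZ.relations := by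
    refine KZ.of_sub_of_sub_sum_mem_relations k Bk R₀ F hR₀d hFd' fun p hp => ?_
    have hF : ∀ j, (F j).integrand p =
        (w j).im / ((1 - p 0 * (w j).re) ^ 2 + (p 0 * (w j).im) ^ 2) / p 1 :=
      fun j => hFi j (by rw [hFd' j]; exact hp)
    rw [hBki hp, hR₀i]
    simp only [Pi.zero_apply, zero_add, hF]
    rw [← Finset.sum_div, hid (p 0)]
  have hR₀ : KZ.of R₀ ∈ KZ.relations :=
    KZ.of_mem_relations_of_eqOn_zero R₀ (by rw [hR₀i]; exact fun _ _ => rfl)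
  have : KZ.of Bk - ∑ j, KZ.of (F j) =
      (KZ.of Bk - KZ.of R₀ - ∑ j, KZ.of (F j)) + KZ.of R₀ := by abel
  rw [this]
  exact KZ.relations.add_mem hsum hR₀

end Summit.KontsevichZagierPeriods.HyperbolicBloch.OffTetraSectorKernel
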